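import Literature.IUT.HodgeTheaters.FrobenioidBridgeEx54ivInfKappaArithTransportCoric
import Literature.IUT.HodgeTheaters.FrobenioidBridgeEx54ivInfKappaArithCompat
import Literature.IUT.HodgeTheaters.InitialThetaDataCurveModelLocalLaws
import HarnessLib

/-!
# [IUTchI] Example 5.4 (iv), p. 149: the `∞κ`-LINK AT THE RECONSTRUCTION PRESENTATION and its `∞κ`-compatibility
# clause BY TRANSPORT — GAP B = G-L5t9g8-1, item GB-14 (`GAP-SIZING-B.md` 2de24246389ab103 §2 row D9, «the
# producer P» of abc-iut-L5-lead RULINGS #315 (2) / #316 (ii); C2 form of record RULINGS #342 (A), #343 (A)(2)/(C),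
# AMENDED by #346 (A); spec-keeper B GB-14 PIN v2 2026-08-28T21:57:05Z)

S. Mochizuki, *Inter-universal Teichmüller theory I*, kurims manuscript (May 2020), Example 5.4 (iv) p. 149
ll. 3–31 («by considering the [poly-]morphisms … restriction of associated Kummer classes determines a collection of
poly-morphisms of pseudo-monoids `π₁^{rat}(†𝒟^⊛) ↷ †𝕄^⊛_{∞κ} → ‡𝕄_{∞κv} ⊆ ‡𝕄_{∞κ×v}` … equivariant with respect to the
various homomorphisms `π₁^{rat}(‡𝒟_v) → π₁^{rat}(†𝒟^⊛)` … induced [cf. … [AbsTopIII], Theorem 1.9, and [AbsTopIII],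
Corollaries 1.10, 2.8] by the given poly-morphism»), with Example 5.1 (i) pp. 123–124 («by applying [AbsTopIII]
Theorem 1.9 … we may construct group-theoretically from `π₁(†𝒟^⊛)` isomorphs `π₁^{rat}(†𝒟^⊛)` … `𝕄^⊛_∞κ(†𝒟^⊚)`»);
S. Mochizuki, *Topics in Absolute Anabelian Geometry III*, Thm 1.9 p. 37, Cor 1.10 p. 41 (tree: the comparison
forms `AbsTopIII.Thm_1_9 (M : CurveModel)`, `AbsTopIII.Cor_1_10_iii M`, `Reconstruction.lean` :164/:273 — instance
forms «consumable only AT A NAMED MODEL»). ([IUTchI] Ex 5.4 (iv) p.149) [claim: Mochizuki2012, status: disputed]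
(D-0012 claim key, series status DISPUTED — THIS file is elementary transport of structure along a ring isomorphism
at OUR typed objects; nothing of the series is asserted and no side is taken on [IUTchIII] Cor. 3.12).

## What is built (STAGE 2 = C2 of RULINGS #316 (ii): «the PROVENANCE layer C2 − C1 … + the transport of (i)»)

For a genuine initial Θ-datum `D`, the stub of record `D.s5LocalThetaOfBadPairs …` (index type `D.IndexCopy ≃ V̲`),
and EVERY reconstruction datum `R : D.ReconRatObjects` (GB-09 ★ p670187: a functorial group-theoretic algorithm `A`
with the comparison clauses of `Thm_1_9 D.nfCurveModel`; ∀-WITNESS form, RULINGS #343 (C) — no `Classical.choose h₁₉`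
on any statement path):
* §0 **`D.ReconEquivariantFor R φ`** — the REPAIRED C2 residual of RULINGS #346 (A) (crit-A finding R-EQ): the
  `Π_{C_F}`-action `R.act` on the Thm-1.9 output `K_A` is, under a GIVEN comparison `φ : K_A ≃+* F̄(t)`, the coefficient
  action of `G_F` through `Π_{C_F} ↠ G_F`; GB-09's `D.ReconEquivariant R` is the instance `φ := R.funFieldEquiv`
  (`reconEquivariant_iff`, `ReconEquivariant.exists_reconEquivariantFor` — nothing landed is lost);
  `ReconEquivariantFor.not_trans` (why the residual of record quantifies `∃ φ`: the predicate is a property of the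
  ELEMENT `φ`, not of the type) and `not_exists_reconEquivariantFor_of_act_eq_refl` (why it is CONTENTFUL: a trivial
  `Π_{C_F}`-action satisfies it for NO `φ` once `G_F` moves a constant).  TYPED; ASSERTED BY NOBODY; never proved here.
* §1 the three `Val K`-level laws of GB-12 ★ p671638 (`Val.resKummerArith_mem_infk/_smul/_op`) TRANSPORTED along GB-09's
  carrier identification `R.infKappaCarrierEquiv` (= `e_A` on elements) and `ρ_A = D.reconRatGalEquiv R`.
* §2 the DECLARED RESIDUALS OF RECORD as ONE Prop-record **`D.C2Residuals G R`** = {`h₁₉ : Thm_1_9 (D.nfCurveModelLocal G)`,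
  `h₁₁₀ : Cor_1_10_iii (D.nfCurveModelLocal G)` BY NAME at GB-13's ENRICHED model ★ p669827 (chair 21:29:37Z; NF-points
  non-vacuous), `hEq : ∃ φ, D.ReconEquivariantFor R φ` (#346 (A))}; non-vacuity of the `∀ R` from `h₁₉`
  (`nonempty_reconRatObjects_of_thm19`, `c2Residuals_reconRatObjectsOfLocal_iff`).
* §3 **`D.infKappaLinkRecon … R` — THE RULED DECLARATION (producer P; GLOBAL SIDE AT THE RECONSTRUCTION PRESENTATION)**:
  `globRat := R.ratGal = Gal(Λ_A/F(t))` (GB-09, the Thm-1.9-presented `π₁^{rat}(†𝒟^⊛)`), `globInfk :=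
  D.reconInfKappaCoricPair R` (`G_A^{rat} ↷ 𝕄_{∞κ}(Λ_A)`, GB-09 companion ★ p671187), local fields = GB-10's model layers
  `D.localInfKappaLayerAt (D.critLocusAt K) x` at `K_v̲` (C1 presentation — the tree holds no local (Cor 1.10) transport
  objects; `h₁₁₀` is carried as a declared residual only), `resKummer := ι_v̲ ∘ e_A` (`Val.resKummerArith … ∘
  R.infKappaCarrierEquiv`), `ratHom := ρ_A⁻¹ ∘ ratHom_v̲` (`Val.ratHomArith`, then `(D.reconRatGalEquiv R).symm`).
* §4 **`D.ex54ivInfKappaCompat_recon … R` — THE RULED THEOREM**: `Ex54ivInfKappaCompat (D.infKappaLinkRecon … R)` for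
  EVERY `R`, BY TRANSPORT from GB-12 (no `hEq`, no residual: #346 (A) «compat-by-transport holds for any iso»).
* §5 the C2 DECIDING STATEMENT `ex54ivInfKappaCompat_recon_under_residuals : D.C2Residuals G R → Ex54ivInfKappaCompat
  (D.infKappaLinkRecon … R)`, whose proof `fun _ ↦ …` DISCARDS the residuals visibly (spec-keeper B PIN v2 (P3): «unused
  by the proof BY DESIGN — C2 = transported only»), and `exists_ex54ivInfKappaCompat_recon_of_thm19`.

HONEST LABELS (crit-A costume test 21:22:11Z; #342 (A); #343 (A); #346 (A)).  (1) **C2 = TRANSPORTED ONLY**: every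
object of the link at the reconstruction presentation is GB-01/02/04/06/10/12's MODEL object carried along the CHOSEN
identification `e_A` (itself extending the `Classical.choice` comparison `φ_A` of `Thm_1_9`'s bare `Nonempty`); the
compatibility theorem has NO content about `Π_{C_F}` beyond GB-12's field theory — it is NOT «the `∞κ`-coric structure
reconstructed group-theoretically from `Π_{C_F}`»; that content is NAMED, not proved, by the residual `hEq` (ERRATA-L5
X-143; provenance-with-equivariance = optional row (α)+(β) / C-b ERRATA I-129, later tranche).  (2) `h₁₉`, `h₁₁₀` are
hypotheses BY NAME at a named model, never the refuted `∀ M`-forms (`not_forall_thm_1_9_b`); as typed they are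
MODEL-TRANSPARENT (#343 (A)(1)).  (3) Archimedean `v`: Galois-shaped local groups are a MODEL label (GAP-SIZING-B R3);
global base `F` (print `F_mod`, design (B), #340 (A)).  (4) COUNT-NEUTRAL: typed / inhabited / proved-by-transport here
≠ proved-in-print ≠ tokened — the token on row `IUTchI:Ex5.4(iv)` moves ONLY by a chair RULINGS line (GB-15, #316 (ii)).
(5) Definitions + theorems only: no `instance`, no notation, no axiom, no `sorry`; nothing here asserts abc proved or refuted.
-/

noncomputable section

namespace Literature.IUT.HodgeTheaters

open CriticalLocus RatBaseChange
open _root_.NumberField _root_.IsDedekindDomain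
open Literature.AnabelianGeometry.AbsoluteAnabelian
open Literature.AnabelianGeometry.AbsoluteAnabelian.AbsTopIII
open Literature.FieldTheory.FunctionField

universe u

namespace InitialThetaData

section Objects

variable {F K Fbar : Type u} [Field F] [NumberField F] [Field K] [NumberField K] [Algebra F K]
  [Field Fbar] [Algebra F Fbar] [Algebra K Fbar] {E : WeierstrassCurve F} [E.IsElliptic] {l : ℕ}
  {Pb : BadPlacePredicates K} (D : InitialThetaData F K Fbar E l Pb)

/-! ### §0. The repaired C2 residual `ReconEquivariantFor` (RULINGS #346 (A)) — typed only, asserted by nobody -/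

/-- **`InitialThetaData.ReconEquivariantFor R φ` — THE C2 DECLARED RESIDUAL OF RECORD (RULINGS #346 (A), cure C-a of
crit-A's finding R-EQ; TYPED ONLY, ASSERTED BY NOBODY)**: for a GIVEN comparison isomorphism `φ : K_A ≃+* F̄(t)` of the
Thm-1.9 output `K_A = R.funField` with the model's NF-function field, the `Π_{C_F}`-action on `K_A` (`R.act g`, through
the algorithm's transport `A.map` along inner isomorphisms — GB-09 companion) is, under `φ`, the COEFFICIENT action of
`G_F = Gal(F̄/F)` on `F̄(t)` through the augmentation `Π_{C_F} ↠ G_F` (`D.augGF`): `φ (g · x) = (φ x)^{augGF g}`.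
«The Thm-1.9 output is `G_F`-equivariantly comparable to `F̄(t)` for SOME comparison» is the residual
`∃ φ, D.ReconEquivariantFor R φ` — print's [AbsTopIII] Thm 1.9 FUNCTORIALITY at the model up to the identification
indeterminacy; our typed `AbsTopIII.Thm_1_9` transcribes (a)(d)(e) as EXISTENCE only (ERRATA-L5 X-143), so this is
where the anabelian content of the C2 lane sits: NAMED here, proved by nobody. ([IUTchI] Ex 5.1 (i) p.124)
[claim: Mochizuki2012, status: disputed] -/
def ReconEquivariantFor (R : D.ReconRatObjects) (φ : R.funField ≃+* RatFunc Fbar) : Prop :=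
  ∀ (g : D.geom.extF.arith) (x : R.funField), φ (R.act g x) = ratFuncMapCoeffs (D.augGF g : Fbar →+* Fbar) (φ x)

variable {D}

/-- GB-09's `D.ReconEquivariant R` (★ p671187 :123) IS `ReconEquivariantFor` at the CHOSEN `φ_A = R.funFieldEquiv :=
Classical.choice _` (definitionally). ([IUTchI] Ex 5.1 (i) p.124) [claim: Mochizuki2012, status: disputed] -/
theorem reconEquivariant_iff (R : D.ReconRatObjects) :
    D.ReconEquivariant R ↔ D.ReconEquivariantFor R R.funFieldEquiv :=
  Iff.rfl

/-- **`ReconEquivariant.exists_reconEquivariantFor` (RULINGS #346 (A), the one-liner of record)**: the pre-amendment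
residual implies the amended one — nothing landed is lost. ([IUTchI] Ex 5.1 (i) p.124) [claim: Mochizuki2012, status: disputed] -/
theorem ReconEquivariant.exists_reconEquivariantFor {R : D.ReconRatObjects} (h : D.ReconEquivariant R) :
    ∃ φ, D.ReconEquivariantFor R φ :=
  ⟨R.funFieldEquiv, h⟩

/-- **Why the residual quantifies over the comparison (crit-A R-EQ (1), kernel form of `REQ.lean`'s
`EquivariantFor.not_trans` at our objects)**: an equivariant comparison `φ` composed with a ring automorphism `τ` of
`F̄(t)` that does not commute with the coefficient action is NOT equivariant — `ReconEquivariantFor R` is a property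
of the ELEMENT `φ`, not of the type `K_A ≃+* F̄(t)`, so its instance at an uninterpreted `Classical.choice` is never
provable once one equivariant `φ` and one such `τ` exist. ([IUTchI] Ex 5.1 (i) p.124) [claim: Mochizuki2012, status: disputed] -/
theorem ReconEquivariantFor.not_trans {R : D.ReconRatObjects} {φ : R.funField ≃+* RatFunc Fbar}
    (hφ : D.ReconEquivariantFor R φ) (τ : RatFunc Fbar ≃+* RatFunc Fbar)
    (hτ : ∃ (g : D.geom.extF.arith) (y : RatFunc Fbar),
      τ (ratFuncMapCoeffs (D.augGF g : Fbar →+* Fbar) y) ≠ ratFuncMapCoeffs (D.augGF g : Fbar →+* Fbar) (τ y)) :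
    ¬ D.ReconEquivariantFor R (φ.trans τ) := by
  intro h
  obtain ⟨g, y, hy⟩ := hτ
  have h1 := h g (φ.symm y)
  rw [RingEquiv.trans_apply, RingEquiv.trans_apply, hφ, RingEquiv.apply_symm_apply] at h1
  exact hy h1

/-- **Why the residual is CONTENTFUL (crit-A R-EQ / spec-keeper B 21:57:05Z (2), kernel form of `REQ.lean`'s
`refl_iff_trivial` at our objects)**: a reconstruction datum whose `Π_{C_F}`-action on `K_A` is TRIVIAL (e.g. an
algorithm with `map := id`) satisfies `ReconEquivariantFor R φ` for NO comparison `φ`, as soon as `G_F` moves one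
constant of `F̄` (`Π_{C_F} ↠ G_F` is onto: `augGF_surjective`).  So a discharge of `∃ φ, D.ReconEquivariantFor R φ` is
a statement about the algorithm `A`, not about the type. ([IUTchI] Ex 5.1 (i) p.124) [claim: Mochizuki2012, status: disputed] -/
theorem not_exists_reconEquivariantFor_of_act_eq_refl {R : D.ReconRatObjects}
    (hact : ∀ g : D.geom.extF.arith, R.act g = RingEquiv.refl R.funField)
    (hcoeff : ∃ (σ : Fbar ≃ₐ[F] Fbar) (c : Fbar), σ c ≠ c) :
    ¬ ∃ φ, D.ReconEquivariantFor R φ := by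
  rintro ⟨φ, hφ⟩
  obtain ⟨σ, c, hc⟩ := hcoeff
  obtain ⟨g, rfl⟩ := D.augGF_surjective σ
  have h := hφ g (φ.symm (RatFunc.C c))
  rw [hact, RingEquiv.refl_apply, RingEquiv.apply_symm_apply, ratFuncMapCoeffs_C] at h
  exact hc (RatFunc.C.injective h.symm)

/-! ### §1. The three `Val K`-level laws of GB-12 TRANSPORTED along `e_A` (carrier) and `ρ_A` (groups) -/

namespace ReconRatObjects

variable [CharZero Fbar] (R : D.ReconRatObjects)

/-- **Clause (a) at `w ∈ V(K)`, reconstruction presentation** («lands in `‡𝕄_{∞κw}`»): `ι_w ∘ e_A` carries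
`𝕄_{∞κ}(Λ_A)` (the carrier of `D.reconInfKappaCoricPair R`) INTO the `∞κ`-coric elements of GB-02's layer at `K_w` —
GB-12's `Val.resKummerArith_mem_infk` (GEOMETRIC clause (a), RULINGS #318) after GB-09's `infKappaCarrierEquiv`
(membership transport, `mapsTo_comp_reconIdentification` shape). ([IUTchI] Ex 5.4 (iv) p.149) [claim: Mochizuki2012, status: disputed] -/
theorem resKummerArith_infKappaCarrierEquiv_mem_infk (w : Val K) (m : (D.reconInfKappaCoricPair R).carrier) :
    letI := (Val.localInfKappaLayer K (D.critLocus.critMap (algebraMap F K)) w).ratGroup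
    letI := (Val.localInfKappaLayer K (D.critLocus.critMap (algebraMap F K)) w).ratTop
    Val.resKummerArith K D.critLocus w (R.infKappaCarrierEquiv m) ∈
      (Val.localInfKappaLayer K (D.critLocus.critMap (algebraMap F K)) w).kit.infk :=
  Val.resKummerArith_mem_infk K D.critLocus w (R.infKappaCarrierEquiv m)

/-- **Clause (b) at `w ∈ V(K)`, reconstruction presentation** («equivariant with respect to …
`π₁^{rat}(‡𝒟_v) → π₁^{rat}(†𝒟^⊛)`»): `ι_w ∘ e_A` is equivariant along `ρ_A⁻¹ ∘ ratHom_w : Gal(Λ_{K_w}/K_w(t)) → G_A^{rat}`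
— GB-09's `infKappaCarrierEquiv_smul` («Galois-compatible BY TRANSPORT», `ρ_A` = conjugation by `e_A`) followed by
GB-12's `Val.resKummerArith_smul` (`smul_comp_reconIdentification` shape). ([IUTchI] Ex 5.4 (iv) p.149)
[claim: Mochizuki2012, status: disputed] -/
theorem resKummerArith_infKappaCarrierEquiv_smul (w : Val K) :
    letI := (Val.localInfKappaLayer K (D.critLocus.critMap (algebraMap F K)) w).ratGroup
    letI := (Val.localInfKappaLayer K (D.critLocus.critMap (algebraMap F K)) w).ratTop
    ∀ (γ : (Val.localInfKappaLayer K (D.critLocus.critMap (algebraMap F K)) w).rat)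
      (m : (D.reconInfKappaCoricPair R).carrier),
      Val.resKummerArith K D.critLocus w (R.infKappaCarrierEquiv
        ((D.reconRatGalEquiv R).symm (Val.ratHomArith (F := F) K (D.critLocus.critMap (algebraMap F K)) w γ) • m)) =
        γ • Val.resKummerArith K D.critLocus w (R.infKappaCarrierEquiv m) := by
  intro γ m
  rw [R.infKappaCarrierEquiv_smul, ContinuousMulEquiv.apply_symm_apply]
  exact Val.resKummerArith_smul K D.critLocus w γ (R.infKappaCarrierEquiv m)

/-- **Clause (c) at `w ∈ V(K)`, reconstruction presentation** (a morphism of pseudo-monoids, [IUTchI] §0 p. 33):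
a product defined in `𝕄_{∞κ}(Λ_A)` is carried by `ι_w ∘ e_A` to the product in `‡𝕄_{∞κ×w}` — GB-09's
`infKappaCarrierEquiv_op` / `mem_dom_iff_infKappaCarrierEquiv` (`e_A` is a ring isomorphism) followed by GB-12's
`Val.resKummerArith_op`. ([IUTchI] Ex 5.4 (iv) p.149) [claim: Mochizuki2012, status: disputed] -/
theorem resKummerArith_infKappaCarrierEquiv_op (w : Val K) (p : (D.reconInfKappaCoricPair R).pm.dom) :
    letI := (Val.localInfKappaLayer K (D.critLocus.critMap (algebraMap F K)) w).ratGroup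
    letI := (Val.localInfKappaLayer K (D.critLocus.critMap (algebraMap F K)) w).ratTop
    ∃ h : (Val.resKummerArith K D.critLocus w (R.infKappaCarrierEquiv p.1.1),
        Val.resKummerArith K D.critLocus w (R.infKappaCarrierEquiv p.1.2)) ∈
        (Val.localInfKappaLayer K (D.critLocus.critMap (algebraMap F K)) w).kit.infkx.pm.dom,
      Val.resKummerArith K D.critLocus w (R.infKappaCarrierEquiv ((D.reconInfKappaCoricPair R).pm.op p)) =
        (Val.localInfKappaLayer K (D.critLocus.critMap (algebraMap F K)) w).kit.infkx.pm.op
          ⟨(Val.resKummerArith K D.critLocus w (R.infKappaCarrierEquiv p.1.1),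
            Val.resKummerArith K D.critLocus w (R.infKappaCarrierEquiv p.1.2)), h⟩ := by
  rw [R.infKappaCarrierEquiv_op]
  exact Val.resKummerArith_op K D.critLocus w
    ⟨(R.infKappaCarrierEquiv p.1.1, R.infKappaCarrierEquiv p.1.2), (R.mem_dom_iff_infKappaCarrierEquiv p.1).mp p.2⟩

end ReconRatObjects

end Objects

/-! ### §2. The DECLARED RESIDUALS OF RECORD as one Prop-record (RULINGS #342 (A) / #343 (A)(2) / #346 (A)) -/

section Residuals

variable {F K Fbar : Type u} [Field F] [NumberField F] [Field K] [NumberField K] [Algebra F K]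
  [Field Fbar] [Algebra F Fbar] [Algebra K Fbar] {E : WeierstrassCurve F} [E.IsElliptic] {l : ℕ}
  {Pb : BadPlacePredicates K} (D : InitialThetaData F K Fbar E l Pb)

/-- **`D.C2Residuals G R` — the DECLARED RESIDUALS OF RECORD of the C2 lane, as ONE Prop-record** (spec-keeper B
PIN v2 (P3); binders of record RULINGS #342 (A) + chair 21:29:37Z + #343 (A)(2) AMENDED by #346 (A)), all BY NAME at
GB-13's ENRICHED model `D.nfCurveModelLocal G` (global curves WITH NF-points ⊕ local curves; clause (a) of `Thm_1_9`
NON-VACUOUS there; input classes discharged by GB-13 ★ p670509): `h₁₉` — [AbsTopIII] Thm 1.9 in comparison form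
(implies GB-07's binder, `thm_1_9_nfCurveModel_of_local`); `h₁₁₀` — [AbsTopIII] Cor 1.10 (iii) in comparison form (the
local curves `C_v, X_v`); `hEq` — `∃ φ, D.ReconEquivariantFor R φ` (#346 (A); the anabelian FUNCTORIALITY content,
ERRATA-L5 X-143).  HONEST LABEL: a record of HYPOTHESES, asserted by nobody; `h₁₉`/`h₁₁₀` as typed are MODEL-TRANSPARENT
(#343 (A)(1)); `G : D.LocalThetaGeometry` is GB-13's hypothesis structure (DATA, not an instance, not a result); the
deciding statement (§5) does NOT consume the record. ([IUTchI] Ex 5.4 (iv) p.149) [claim: Mochizuki2012, status: disputed] -/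
structure C2Residuals (G : D.LocalThetaGeometry) (R : D.ReconRatObjects) : Prop where
  /-- [AbsTopIII] Thm 1.9 BY NAME at the enriched model (RULINGS #342 (A); chair 21:29:37Z) -/
  h₁₉ : Thm_1_9 (D.nfCurveModelLocal G)
  /-- [AbsTopIII] Cor 1.10 (iii) BY NAME at the enriched model (local curves `C_v, X_v`: `cor_1_10_iii_localCurveModel_of_local`) -/
  h₁₁₀ : Cor_1_10_iii (D.nfCurveModelLocal G)
  /-- the amended equivariance residual of RULINGS #346 (A): SOME comparison `K_A ≃+* F̄(t)` is `Π_{C_F}`/`G_F`-equivariant -/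
  hEq : ∃ φ, D.ReconEquivariantFor R φ

/-- **NON-VACUITY of the `∀ R` from `h₁₉` BY NAME at the enriched model** (PIN v2 (P4): `∃ R` is NOT claimed — that is
`h₁₉`): GB-09's projection `D.reconRatObjectsOfLocal G h₁₉`. ([IUTchI] Ex 5.1 (i) p.124) [claim: Mochizuki2012, status: disputed] -/
theorem nonempty_reconRatObjects_of_thm19 (G : D.LocalThetaGeometry) (h₁₉ : Thm_1_9 (D.nfCurveModelLocal G)) :
    Nonempty D.ReconRatObjects :=
  ⟨D.reconRatObjectsOfLocal G h₁₉⟩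

/-- At the binder's projection `R := D.reconRatObjectsOfLocal G h₁₉` the residual record is `h₁₁₀ ∧ hEq`. ([IUTchI] Ex 5.4 (iv) p.149)
[claim: Mochizuki2012, status: disputed] -/
theorem c2Residuals_reconRatObjectsOfLocal_iff (G : D.LocalThetaGeometry) (h₁₉ : Thm_1_9 (D.nfCurveModelLocal G)) :
    D.C2Residuals G (D.reconRatObjectsOfLocal G h₁₉) ↔ Cor_1_10_iii (D.nfCurveModelLocal G) ∧
      ∃ φ, D.ReconEquivariantFor (D.reconRatObjectsOfLocal G h₁₉) φ :=
  ⟨fun ρ => ⟨ρ.h₁₁₀, ρ.hEq⟩, fun h => ⟨h₁₉, h.1, h.2⟩⟩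

end Residuals

/-! ### §3. THE RULED DECLARATION: the `∞κ`-link at the reconstruction presentation (producer P, RULINGS #315 (2)) -/

section Datum

variable {F K Fbar : Type u} [Field F] [NumberField F] [Field K] [NumberField K]
  [Algebra F K] [Field Fbar] [Algebra F Fbar] [Algebra K Fbar]
  {E : WeierstrassCurve F} [E.IsElliptic] {l : ℕ} {Pb : BadPlacePredicates K}
  (D : InitialThetaData F K Fbar E l Pb) (CG : D.geom.pe.CuspGalois) (hS : D.CuspClassesNormaliserStable) [Fact l.Prime]
  (M : D.TorsionMonodromy) (hA : D.geom.pe.ArrowCoveringClaims)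
  (hI : ∀ k ∈ D.geom.pe.inertia D.geom.pe.ε1, M.tau (D.geom.embK k) = 0)
  (B : ∀ v, v ∈ D.indexCopyBad → D.BadPairAt v) (ΛBad : ∀ v (h : v ∈ D.indexCopyBad), D.LocalArrowLaw CG hS (B v h).H)
  {Gv : D.IndexCopy → Subgroup (Fbar ≃ₐ[F] Fbar)}
  (ES : ∀ v, v ∈ D.indexCopyBad → EvalSectionBinder (D.localDataOfBadPairs CG hS M hA hI B ΛBad v) (Gv v))

/-- **GAP B item GB-14, THE RULED DECLARATION — the `∞κ`-link of [IUTchI] Example 5.4 (iv) AT THE RECONSTRUCTION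
PRESENTATION, for EVERY reconstruction datum `R : D.ReconRatObjects`** (the producer `P` of RULINGS #315 (2) /
#316 (ii), ∀-witness form #343 (C)): GLOBAL side = the [AbsTopIII]-Thm-1.9-presented objects of GB-09 —
`globRat := R.ratGal = G_A^{rat} = Gal(Λ_A/F(t))` («`π₁^{rat}(†𝒟^⊛)`»), `globInfk := D.reconInfKappaCoricPair R`
(«`π₁^{rat}(†𝒟^⊛) ↷ †𝕄^⊛_{∞κ}`» = `G_A^{rat} ↷ 𝕄_{∞κ}(Λ_A)`); LOCAL side = GB-10's model layers
`D.localInfKappaLayerAt (D.critLocusAt K) x` at the completion `K_v̲`, `v̲ = D.indexCopyVal x` (C1 presentation: the tree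
holds no local [AbsTopIII] Cor 1.10 transport objects — `h₁₁₀` is a DECLARED RESIDUAL only, §2); operations
`resKummer _ x _ _ := ι_v̲ ∘ e_A` (GB-10's `Val.resKummerArith` after GB-09's carrier identification
`R.infKappaCarrierEquiv`) and `ratHom _ x _ _ := ρ_A⁻¹ ∘ ratHom_v̲` (GB-10's `Val.ratHomArith` followed by
`(D.reconRatGalEquiv R).symm : G_F^{rat} ≃ₜ* G_A^{rat}`), CONSTANT in `Z / (v, F) / d / f` (R5, one representative).
HONEST LABEL (crit-A costume test): TRANSPORTED, NOT RECONSTRUCTED — every field is a MODEL object of design (B) carried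
along the chosen identification `e_A`; count-neutral (#316). ([IUTchI] Ex 5.4 (iv) p.149) [claim: Mochizuki2012, status: disputed] -/
def infKappaLinkRecon (R : D.ReconRatObjects) : (D.s5LocalThetaOfBadPairs CG hS M hA hI B ΛBad ES).InfKappaLink :=
  haveI : CharZero Fbar := charZero_of_injective_algebraMap (algebraMap F Fbar).injective
  { globRat := fun _ => R.ratGal
    globRatGroup := fun _ => inferInstance
    globRatTop := fun _ => inferInstance
    globInfk := fun _ => D.reconInfKappaCoricPair R
    locRat := fun x _ => (D.localInfKappaLayerAt (D.critLocusAt K) x).rat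
    locRatGroup := fun x _ => (D.localInfKappaLayerAt (D.critLocusAt K) x).ratGroup
    locRatTop := fun x _ => (D.localInfKappaLayerAt (D.critLocusAt K) x).ratTop
    locInfkx := fun x _ =>
      letI := (D.localInfKappaLayerAt (D.critLocusAt K) x).ratGroup
      letI := (D.localInfKappaLayerAt (D.critLocusAt K) x).ratTop
      (D.localInfKappaLayerAt (D.critLocusAt K) x).kit.infkx
    locInfk := fun x _ =>
      letI := (D.localInfKappaLayerAt (D.critLocusAt K) x).ratGroup
      letI := (D.localInfKappaLayerAt (D.critLocusAt K) x).ratTop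
      (D.localInfKappaLayerAt (D.critLocusAt K) x).kit.infk
    resKummer := fun _ x _ _ m => Val.resKummerArith K D.critLocus (D.indexCopyVal x) (R.infKappaCarrierEquiv m)
    ratHom := fun _ x _ _ =>
      letI := (D.localInfKappaLayerAt (D.critLocusAt K) x).ratGroup
      letI := (D.localInfKappaLayerAt (D.critLocusAt K) x).ratTop
      ((D.reconRatGalEquiv R).symm : RatGal F →ₜ* R.ratGal).comp
        (Val.ratHomArith K (D.critLocusAt K) (D.indexCopyVal x)) }

/-! #### Bookkeeping: the fields of the link, by `rfl` -/

section Bookkeeping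

variable [CharZero Fbar] (R : D.ReconRatObjects)  -- `CharZero F̄`: the statements below name GB-09's `𝕄_{∞κ}(Λ_A)`

/-- The global coric pair of the link is GB-09's `D.reconInfKappaCoricPair R` (`G_A^{rat} ↷ 𝕄_{∞κ}(Λ_A)`), whatever `Z`.
([IUTchI] Ex 5.1 (v) p.127) [claim: Mochizuki2012, status: disputed] -/
theorem infKappaLinkRecon_globInfk (Z : (D.s5LocalThetaOfBadPairs CG hS M hA hI B ΛBad ES).FAmbGlob) :
    (D.infKappaLinkRecon CG hS M hA hI B ΛBad ES R).globInfk Z = D.reconInfKappaCoricPair R := rfl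

/-- `resKummer` of the link is `ι_v̲ ∘ e_A` = `Val.resKummerArith … ∘ R.infKappaCarrierEquiv` at `v̲ = D.indexCopyVal x`,
whatever `Z`, `d`, `f`. ([IUTchI] Ex 5.4 (iv) p.149) [claim: Mochizuki2012, status: disputed] -/
theorem infKappaLinkRecon_resKummer {Y : (D.s5LocalThetaOfBadPairs CG hS M hA hI B ΛBad ES).FAmbG}
    {Z : (D.s5LocalThetaOfBadPairs CG hS M hA hI B ΛBad ES).FAmbGlob}
    (d : (D.s5LocalThetaOfBadPairs CG hS M hA hI B ΛBad ES).DashArrow Y Z) {x : D.IndexCopy}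
    (X : (D.s5LocalThetaOfBadPairs CG hS M hA hI B ΛBad ES).FAmb x)
    (f : (D.baseThetaDatumThetaOfBadPairs CG hS M hA hI B ΛBad ES).HomNF x
      (((D.s5LocalThetaOfBadPairs CG hS M hA hI B ΛBad ES).base x).obj X)
      ((D.s5LocalThetaOfBadPairs CG hS M hA hI B ΛBad ES).baseG Y)) :
    (D.infKappaLinkRecon CG hS M hA hI B ΛBad ES R).resKummer d X f =
      Val.resKummerArith K D.critLocus (D.indexCopyVal x) ∘ R.infKappaCarrierEquiv := rfl

end Bookkeeping

/-- `ratHom` of the link is `ρ_A⁻¹ ∘ ratHom_v̲` at `v̲ = D.indexCopyVal x`, on elements, whatever `Z`, `d`, `f`.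
([IUTchI] Ex 5.4 (iv) p.149) [claim: Mochizuki2012, status: disputed] -/
theorem infKappaLinkRecon_ratHom_apply (R : D.ReconRatObjects) {Y : (D.s5LocalThetaOfBadPairs CG hS M hA hI B ΛBad ES).FAmbG}
    {Z : (D.s5LocalThetaOfBadPairs CG hS M hA hI B ΛBad ES).FAmbGlob}
    (d : (D.s5LocalThetaOfBadPairs CG hS M hA hI B ΛBad ES).DashArrow Y Z) {x : D.IndexCopy}
    (X : (D.s5LocalThetaOfBadPairs CG hS M hA hI B ΛBad ES).FAmb x)
    (f : (D.baseThetaDatumThetaOfBadPairs CG hS M hA hI B ΛBad ES).HomNF x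
      (((D.s5LocalThetaOfBadPairs CG hS M hA hI B ΛBad ES).base x).obj X)
      ((D.s5LocalThetaOfBadPairs CG hS M hA hI B ΛBad ES).baseG Y))
    (γ : (D.localInfKappaLayerAt (D.critLocusAt K) x).rat) :
    (D.infKappaLinkRecon CG hS M hA hI B ΛBad ES R).ratHom d X f γ =
      (D.reconRatGalEquiv R).symm (Val.ratHomArith K (D.critLocusAt K) (D.indexCopyVal x) γ) := rfl


/-! ### §4. THE RULED THEOREM: the `∞κ`-compatibility clause at the reconstruction presentation, BY TRANSPORT -/

/-- **GAP B item GB-14, THE RULED THEOREM — [IUTchI] Example 5.4 (iv)'s `∞κ`-compatibility clause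
`Ex54ivInfKappaCompat` (★ p513361) HOLDS at the reconstruction-presented link `D.infKappaLinkRecon … R`, for EVERY
`R : D.ReconRatObjects`, BY TRANSPORT from GB-12 ★ p671638**: for every `ℱ`-prime-strip `X`, every `†ℱ^⊚ ⇢ †ℱ^⊛`,
every `δ`, every `v ∈ V̲` and every member `f` of the induced `‡𝒟_v → †𝒟^⊚`, restriction of Kummer classes
`ι_v̲ ∘ e_A : 𝕄_{∞κ}(Λ_A) → ‡𝕄_{∞κ×v}` (a) LANDS IN `‡𝕄_{∞κv}` (geometric clause (a), #318), (b) is EQUIVARIANT along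
`ρ_A⁻¹ ∘ ratHom_v̲ : Gal(Λ_{K_v̲}/K_v̲(t)) → G_A^{rat}`, (c) is a morphism of pseudo-monoids — §1's three transported laws
at `w := D.indexCopyVal v`.  As at GB-12 the hypothesis `f ∈ FPolyHomNF.under δ v` is not used (operations CONSTANT in
`f`, R5).  NO residual is a hypothesis here (#346 (A): compatibility BY TRANSPORT holds along ANY identification — it
would be decoration); the residuals of record are CARRIED by §2/§5.  HONEST LABEL: «C2 = transported only» — no content
about `Π_{C_F}` beyond GB-12's field theory (crit-A costume test (ii)); COUNT-NEUTRAL until the chair's RULINGS line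
(#316 (ii)); typed and proved here ≠ proved-in-print ≠ tokened. ([IUTchI] Ex 5.4 (iv) p.149) [claim: Mochizuki2012, status: disputed] -/
theorem ex54ivInfKappaCompat_recon (R : D.ReconRatObjects) :
    BaseThetaDatum.S5Local.Ex54ivInfKappaCompat (D.infKappaLinkRecon CG hS M hA hI B ΛBad ES R) := by
  haveI : CharZero Fbar := charZero_of_injective_algebraMap (algebraMap F Fbar).injective
  intro X Y Z d δ v f _
  exact ⟨fun m => R.resKummerArith_infKappaCarrierEquiv_mem_infk (D.indexCopyVal v) m,
    R.resKummerArith_infKappaCarrierEquiv_smul (D.indexCopyVal v),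
    R.resKummerArith_infKappaCarrierEquiv_op (D.indexCopyVal v)⟩

/-- **Non-degeneracy of the reconstruction-presented global pseudo-monoid**: for every `Z`, the carrier of
`globInfk Z` (= `𝕄_{∞κ}(Λ_A)`) contains the image under `K_A → Λ_A` of (the `φ_A`-preimage of) a NON-CONSTANT `κ`-coric
function — GB-09 companion's `exists_mem_infKappaSet_ne_C` (GB-04's Rmk 3.1.7 (ii) witness); so the clause just proved
is not about a roots-of-unity-only structure. ([IUTchI] Rmk 3.1.7 (ii) p.67) [claim: Mochizuki2012, status: disputed] -/
theorem exists_globInfk_infKappaLinkRecon_ne_C (R : D.ReconRatObjects)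
    (Z : (D.s5LocalThetaOfBadPairs CG hS M hA hI B ΛBad ES).FAmbGlob) :
    letI := (D.infKappaLinkRecon CG hS M hA hI B ΛBad ES R).globRatGroup Z
    letI := (D.infKappaLinkRecon CG hS M hA hI B ΛBad ES R).globRatTop Z
    ∃ (m : ((D.infKappaLinkRecon CG hS M hA hI B ΛBad ES R).globInfk Z).carrier) (g : RatFunc Fbar),
      (m.val : R.ratClosure) = algebraMap R.funField R.ratClosure (R.funFieldEquiv.symm g) ∧
        ∀ c : Fbar, g ≠ RatFunc.C c := by
  haveI : CharZero Fbar := charZero_of_injective_algebraMap (algebraMap F Fbar).injective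
  obtain ⟨g, hg, hne⟩ := R.exists_mem_infKappaSet_ne_C
  exact ⟨⟨_, hg⟩, g, rfl, hne⟩

/-! ### §5. The C2 deciding statement under the residuals of record, and non-vacuity of the `∀ R` -/

/-- **THE C2 DECIDING STATEMENT OF RECORD (spec-keeper B PIN v2 (P3); RULINGS #343 (A)(2) as AMENDED by #346 (A))**:
UNDER THE DECLARED RESIDUALS `{h₁₉, h₁₁₀ BY NAME at D.nfCurveModelLocal G; hEq := ∃ φ, ReconEquivariantFor R φ}` the
`∞κ`-compatibility clause of [IUTchI] Ex 5.4 (iv) holds at the reconstruction-presented link `D.infKappaLinkRecon … R`.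
HONEST LABEL, DISPLAYED IN THE PROOF TERM `fun _ ↦ …`: the residuals are UNUSED BY DESIGN — the conclusion is §4's
`ex54ivInfKappaCompat_recon R`, which holds for EVERY `R` BY TRANSPORT; «C2 = transported only»; the residual record
NAMES what a provenance-with-equivariance closure would have to discharge (optional row (α)+(β) / C-b ERRATA I-129) and
is asserted by nobody.  COUNT-NEUTRAL: the B-token consequence (#343 (A)(3) / #346 (A)) is the director's and the
chair's (GB-15), never this file's. ([IUTchI] Ex 5.4 (iv) p.149) [claim: Mochizuki2012, status: disputed] -/
theorem ex54ivInfKappaCompat_recon_under_residuals (G : D.LocalThetaGeometry) (R : D.ReconRatObjects) :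
    D.C2Residuals G R →
      BaseThetaDatum.S5Local.Ex54ivInfKappaCompat (D.infKappaLinkRecon CG hS M hA hI B ΛBad ES R) :=
  fun _ => D.ex54ivInfKappaCompat_recon CG hS M hA hI B ΛBad ES R

/-- **Under `h₁₉` BY NAME at the enriched model there IS a reconstruction datum, and at its link the clause holds**
(non-vacuous reading of §4's `∀ R`; the witness is GB-09's projection of the binder, the clause is §4 by transport).
([IUTchI] Ex 5.4 (iv) p.149) [claim: Mochizuki2012, status: disputed] -/
theorem exists_ex54ivInfKappaCompat_recon_of_thm19 (G : D.LocalThetaGeometry)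
    (h₁₉ : Thm_1_9 (D.nfCurveModelLocal G)) :
    ∃ R : D.ReconRatObjects,
      BaseThetaDatum.S5Local.Ex54ivInfKappaCompat (D.infKappaLinkRecon CG hS M hA hI B ΛBad ES R) :=
  ⟨D.reconRatObjectsOfLocal G h₁₉, D.ex54ivInfKappaCompat_recon CG hS M hA hI B ΛBad ES _⟩

end Datum

end InitialThetaData

end Literature.IUT.HodgeTheaters

end
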